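import Literature.Probability.LatticeModels.SharpnessLROProofs
import Literature.Probability.LatticeModels.FreeStateGibbs
import Literature.Probability.LatticeModels.GibbsSpecificationProofs
import Literature.Probability.LatticeModels.GibbsSpecificationDLRProofs
import HarnessLib

/-!
# The energy of a translation invariant Gibbs state is at least the left `β`-derivative of the pressure

Topic `Probability/LatticeModels`, namespace `Literature.Probability.LatticeModels`. Theorem-only file
(no definitions, no named facts): the "general arguments" step of J. L. Lebowitz, *Coexistence of
phases in Ising ferromagnets*, J. Stat. Phys. **16** (1977) 463–476, §3, proof of Thm. 2, p. 470
("it follows from general arguments that `∂Ψ(β_0 ± 0)/∂β` … the energies of all translation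
invariant states lie between these one-sided derivatives"), for the nearest-neighbour Ising model
on `ℤ^d` at zero field, in the elementary chord form that avoids the variational principle:

* `pressure_sub_pressure_le_mul_sum_spinCorr_nn` — for every translation invariant
  `μ ∈ 𝒢(β, 0)` and every `β' < β`,
  `ψ(β) - ψ(β') ≤ (β - β') ∑ᵢ ⟨σ_0σ_{eᵢ}⟩_μ`.
  Proof: in the box `Λ = B(L+1)` with the boundary condition `η`, convexity of `log Z^η_Λ` in `β`
  gives `log Z^η_Λ(β) - log Z^η_Λ(β') ≤ (β-β') ⟨-H^η_Λ⟩^η_{Λ;β}` (the tree's Gibbs–Jensen chord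
  inequality `mul_isingExpect_neg_hamiltonian_le_log_sub`); the left side is within
  `(|β|+|β'|)|∂ᵉΛ|` of `log Z^∅_Λ(β) - log Z^∅_Λ(β')` uniformly in `η` (Friedli–Velenik 2017, proof
  of Thm. 3.6, p. 97; `abs_log_isingPartitionFunction_sub_free_le`); integrating against `μ(dη)`,
  the DLR equations turn `∫ ⟨-H^η_Λ⟩^η_{Λ;β} μ(dη)` into `∑_{e ∈ ℰ^b_Λ} μ(σ_e)`, which by
  translation invariance is `|Λ| ∑ᵢ ⟨σ_0σ_{eᵢ}⟩_μ` up to boundary terms `O(|∂Λ|)`; dividing by `|Λ|`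
  and letting `L → ∞` (`|∂B(L)|/|B(L)| → 0`, `ψ^∅_{B(L)} → ψ`).
* `mul_sum_plusCorr_nn_le_pressure_sub_pressure` — the matching lower bound from the plus
  boundary condition, `(β-β') ∑ᵢ ⟨σ_0σ_{eᵢ}⟩⁺_{β'} ≤ ψ(β) - ψ(β')` for `0 ≤ β' < β` (Step A of
  `SharpnessLROProofs.lean`, isolated).
* `sum_plusCorr_nn_le_sum_spinCorr_nn_of_isTranslationInvariant` — hence
  `∑ᵢ ⟨σ_0σ_{eᵢ}⟩⁺_{β'} ≤ ∑ᵢ ⟨σ_0σ_{eᵢ}⟩_μ` for all `0 ≤ β' < β`: the nearest-neighbour energy of a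
  translation invariant Gibbs state at `β` is at least `lim_{β'↑β}` of the plus energies, the left
  derivative of the pressure (Lebowitz 1977, §3, p. 470).

Supporting lemmas: DLR averages of bounded observables, translation invariance of the
correlations of a translation invariant measure, the bond sums over a box, `|∂ᵉB(L)|/|B(L)| → 0`.

## Mathlib status

No lattice pressure / Gibbs measures in Mathlib. Anchors: `integral_mono`, `integral_finsetSum`,
`StronglyMeasurable.integral_kernel`, `Finset.sum_sdiff`, `le_of_tendsto_of_tendsto'`,
`Filter.Tendsto.div_const`; tree: `mul_isingExpect_neg_hamiltonian_le_log_sub`,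
`isingExpect_neg_hamiltonian_zero_field`, `sum_edgesIn_zd`, `box_subset_filter_box_succ`,
`tendsto_card_box_div_card_box_succ`, `le_isingExpect_neg_hamiltonian_plus_box`,
`pair_add_eq_map_shift` (`SharpnessLROProofs.lean`), `abs_log_isingPartitionFunction_sub_free_le`,
`card_edgeBoundary_le_of_degree_le` (`IsingPressureBounds.lean`), `hasBoxLimit_pressureIn_holds`,
`card_incidenceFinset_zdGraph_le`, `tendsto_pow_add_two_sub_pow_div`
(`IsingThermodynamicsProofs.lean`), `card_outerBoundary_box_add_le`
(`ThermodynamicLimitProofs.lean`), `spinProduct_configShift` (`FreeStateGibbs.lean`),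
`IsGibbsMeasure.integral_integral_eq` (`GibbsSpecificationDLRProofs.lean`).

## References

* J. L. Lebowitz, *Coexistence of phases in Ising ferromagnets*, J. Stat. Phys. 16 (1977)
  463–476, §3, proof of Thm. 2, p. 470.
* S. Friedli, Y. Velenik, *Statistical Mechanics of Lattice Systems*, CUP (2017), §3.2.1
  (Lemma 3.5, Exercise 3.2), Thm. 3.6 and its proof (p. 97), Thm. 3.17, Def. 6.13, Exercise 6.6.
-/

noncomputable section

open MeasureTheory Filter Topology Finset ProbabilityTheory

namespace Literature.Probability.LatticeModels

/-! ### DLR averages of bounded observables -/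

section DLR

variable {V : Type*} (G : SimpleGraph V) [DecidableEq V] [G.LocallyFinite] [Countable V]

omit [DecidableEq V] [G.LocallyFinite] [Countable V] in
/-- `|σ_x σ_y| ≤ 1` for every bond (also `abs_bondSpin_le_one'` of `IsingFieldVolume.lean`, not
imported here). [folklore] -/
private theorem abs_bondSpin_le_one (σ : SpinConfig V) (e : Sym2 V) : |bondSpin σ e| ≤ 1 := by
  induction e using Sym2.ind with
  | _ x y => rw [bondSpin_mk, abs_mul, abs_spinAt, abs_spinAt, mul_one]

omit [DecidableEq V] [G.LocallyFinite] [Countable V] in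
/-- A bond observable is integrable against any finite measure. [folklore] -/
theorem integrable_bondSpin (μ : Measure (SpinConfig V)) [IsFiniteMeasure μ] (e : Sym2 V) :
    Integrable (fun σ : SpinConfig V => bondSpin σ e) μ :=
  Integrable.of_bound (measurable_bondSpin e).aestronglyMeasurable 1
    (Eventually.of_forall fun σ => by rw [Real.norm_eq_abs]; exact abs_bondSpin_le_one σ e)

omit [DecidableEq V] [G.LocallyFinite] [Countable V] in
/-- `∫ σ_e dμ ≤ 1` for a probability measure. [folklore] -/
theorem integral_bondSpin_le_one (μ : Measure (SpinConfig V)) [IsProbabilityMeasure μ] (e : Sym2 V) :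
    ∫ σ, bondSpin σ e ∂μ ≤ 1 := by
  calc ∫ σ, bondSpin σ e ∂μ ≤ ∫ _, (1 : ℝ) ∂μ :=
        integral_mono (integrable_bondSpin μ e) (integrable_const _) fun σ =>
          (abs_le.1 (abs_bondSpin_le_one σ e)).2
    _ = 1 := by simp

/-- `η ↦ ⟨f⟩^η_{Λ;β,h}` is integrable against a finite measure, for `f` measurable and bounded
(kernel measurability of the Ising specification, Friedli–Velenik 2017, Lemma 6.7 / Thm. 6.8). [cite: FriedliVelenik2017, Lemma 6.7 and Thm. 6.8] -/
theorem integrable_isingExpect_fixed (μ : Measure (SpinConfig V)) [IsFiniteMeasure μ]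
    (Λ : Finset V) (β h : ℝ) {f : SpinConfig V → ℝ} (hf : Measurable f) {C : ℝ}
    (hC : ∀ σ, |f σ| ≤ C) :
    Integrable (fun η : SpinConfig V => isingExpect G Λ β h (.fixed η) f) μ := by
  have hγ : IsSpecification (isingSpecification G β h) := isSpecification_isingSpecification_holds G β h
  have hsm : StronglyMeasurable fun η : SpinConfig V => isingExpect G Λ β h (.fixed η) f :=
    hf.stronglyMeasurable.integral_kernel
      (κ := (⟨isingSpecification G β h Λ, hγ.measurable_fun Λ⟩ : Kernel (SpinConfig V) (SpinConfig V)))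
  refine Integrable.of_bound hsm.aestronglyMeasurable C (Eventually.of_forall fun η => ?_)
  have hC' : ∀ σ, ‖f σ‖ ≤ C := fun σ => by rw [Real.norm_eq_abs]; exact hC σ
  show ‖∫ σ, f σ ∂(isingMeasure G Λ β h (.fixed η))‖ ≤ C
  simpa using norm_integral_le_of_norm_le_const (μ := isingMeasure G Λ β h (.fixed η))
    (Eventually.of_forall hC')

/-- **DLR equations for bounded observables**: `∫ ⟨f⟩^η_{Λ;β,h} μ(dη) = ∫ f dμ` for `μ ∈ 𝒢(β,h)`
(Friedli–Velenik 2017, Def. 6.13 and Exercise 6.6). [cite: FriedliVelenik2017, Def. 6.13 and Exercise 6.6] -/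
theorem integral_isingExpect_fixed_eq_integral {β h : ℝ} {μ : Measure (SpinConfig V)}
    (hμ : IsGibbsMeasure (isingSpecification G β h) μ) (Λ : Finset V) {f : SpinConfig V → ℝ}
    (hf : Measurable f) {C : ℝ} (hC : ∀ σ, |f σ| ≤ C) :
    ∫ η, isingExpect G Λ β h (.fixed η) f ∂μ = ∫ σ, f σ ∂μ := by
  haveI := hμ.isProbabilityMeasure
  have hγ : IsSpecification (isingSpecification G β h) := isSpecification_isingSpecification_holds G β h
  exact hμ.integral_integral_eq hγ Λ (Integrable.of_bound hf.aestronglyMeasurable C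
    (Eventually.of_forall fun σ => by rw [Real.norm_eq_abs]; exact hC σ))

end DLR

/-! ### Translation invariant measures on `ℤ^d` -/

section Shift

variable {d : ℕ}

/-- The correlations of a translation invariant measure are translation invariant:
`⟨σ_{A+v}⟩_μ = ⟨σ_A⟩_μ` (Georgii 2011, Ch. 5, (5.4); Friedli–Velenik 2017, §6.4). [cite: Georgii2011, Ch. 5, Def. (5.4)] -/
theorem spinCorr_map_shift_of_isTranslationInvariant {μ : Measure (SpinConfig (Site d))}
    (hμ : IsTranslationInvariantMeasure μ) (v : Site d) (A : Finset (Site d)) :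
    spinCorr μ (A.map (Site.shift v).toEmbedding) = spinCorr μ A := by
  set B := A.map (Site.shift v).toEmbedding with hB
  have hBA : B.map (Site.shift (-v)).toEmbedding = A := by
    ext x
    simp only [hB, Finset.mem_map, Equiv.toEmbedding_apply, Site.shift_apply]
    constructor
    · rintro ⟨_, ⟨a, ha, rfl⟩, rfl⟩
      simpa using ha
    · intro hx
      exact ⟨x + v, ⟨x, hx, rfl⟩, by simp⟩
  calc spinCorr μ B = ∫ σ, spinProduct B σ ∂(μ.map (configShift v)) := by rw [hμ v]; rfl
    _ = ∫ σ, spinProduct B (configShift v σ) ∂μ :=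
        integral_map (configShift v).measurable.aemeasurable
          (measurable_spinProduct B).aestronglyMeasurable
    _ = spinCorr μ A := by
        simp_rw [spinProduct_configShift v B, hBA]
        rfl

/-- In particular `⟨σ_yσ_{y+v}⟩_μ = ⟨σ_0σ_v⟩_μ` for a translation invariant `μ`. [cite: Georgii2011, Ch. 5, Def. (5.4)] -/
theorem spinCorr_pair_shift_of_isTranslationInvariant {μ : Measure (SpinConfig (Site d))}
    (hμ : IsTranslationInvariantMeasure μ) (y v : Site d) :
    spinCorr μ {y, y + v} = spinCorr μ {0, v} := by
  rw [pair_add_eq_map_shift, spinCorr_map_shift_of_isTranslationInvariant hμ]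

/-- The bond expectation of a translation invariant measure in direction `i`:
`∫ σ_yσ_{y+eᵢ} dμ = ⟨σ_0σ_{eᵢ}⟩_μ`. [cite: Georgii2011, Ch. 5, Def. (5.4)] -/
theorem integral_bondSpin_dirEdge_of_isTranslationInvariant {μ : Measure (SpinConfig (Site d))}
    (hμ : IsTranslationInvariantMeasure μ) (y : Site d) (i : Fin d) :
    ∫ σ, bondSpin σ s(y, y + Pi.single i 1) ∂μ = spinCorr μ {0, Pi.single i 1} := by
  rw [← spinCorr_pair_shift_of_isTranslationInvariant hμ y (Pi.single i 1), spinCorr,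
    ← spinPair_eq_spinProduct (ne_add_unitVec y i)]
  rfl

end Shift

/-! ### Boxes: the edge boundary is negligible -/

section Boxes

variable {d : ℕ}

/-- `|∂ᵉB(L)| / |B(L)| → 0` (the boxes are a van Hove sequence; Friedli–Velenik 2017, §3.2.1,
Exercise 3.1, with `|∂ᵉΛ| ≤ 2d |∂ᵉˣΛ|`). [cite: FriedliVelenik2017, §3.2.1, Exercise 3.1] -/
theorem tendsto_card_edgeBoundary_box_div (d : ℕ) :
    Tendsto (fun L : ℕ => (#(edgeBoundary (zdGraph d) (box d L)) : ℝ) / #(box d L)) atTop (𝓝 0) := by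
  have h0 : Tendsto (fun L : ℕ => 2 * (L : ℝ) + 1) atTop atTop :=
    tendsto_atTop_mono (fun L => by linarith [(Nat.cast_nonneg L : (0 : ℝ) ≤ L)])
      tendsto_natCast_atTop_atTop
  have he : Tendsto (fun L : ℕ => (2 * d : ℝ) *
      (((2 * (L : ℝ) + 1 + 2) ^ d - (2 * (L : ℝ) + 1) ^ d) / (2 * (L : ℝ) + 1) ^ d)) atTop (𝓝 0) := by
    have h1 := (tendsto_pow_add_two_sub_pow_div d h0).const_mul (2 * d : ℝ)
    rwa [mul_zero] at h1
  refine squeeze_zero (fun L => by positivity) (fun L => ?_) he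
  have hcard : (#(box d L) : ℝ) = (2 * (L : ℝ) + 1) ^ d := by rw [card_box]; push_cast; ring
  have h3 := card_edgeBoundary_le_of_degree_le (zdGraph d) card_incidenceFinset_zdGraph_le (box d L)
  have h4 : (#(outerBoundary (zdGraph d) (box d L)) : ℝ) + (2 * (L : ℝ) + 1) ^ d ≤
      (2 * (L : ℝ) + 3) ^ d := by exact_mod_cast card_outerBoundary_box_add_le d L
  have h2 : (#(edgeBoundary (zdGraph d) (box d L)) : ℝ) ≤
      2 * d * ((2 * (L : ℝ) + 1 + 2) ^ d - (2 * (L : ℝ) + 1) ^ d) := by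
    calc (#(edgeBoundary (zdGraph d) (box d L)) : ℝ)
        ≤ ((2 * d * #(outerBoundary (zdGraph d) (box d L)) : ℕ) : ℝ) := by exact_mod_cast h3
      _ = 2 * d * (#(outerBoundary (zdGraph d) (box d L)) : ℝ) := by push_cast; ring
      _ ≤ 2 * d * ((2 * (L : ℝ) + 1 + 2) ^ d - (2 * (L : ℝ) + 1) ^ d) := by
          refine mul_le_mul_of_nonneg_left ?_ (by positivity)
          rw [show (2 * (L : ℝ) + 1 + 2) = 2 * L + 3 by ring]
          linarith
  rw [hcard, mul_div_assoc']
  exact div_le_div_of_nonneg_right h2 (by positivity)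

/-- The number of edges of `B(L+1)` in a fixed direction is between `|B(L)|` and `|B(L+1)|`: the
directed bond count `#{y ∈ B(L+1) : y + eᵢ ∈ B(L+1)}`. [folklore] -/
theorem card_box_le_card_filter_dirEdge (i : Fin d) (L : ℕ) :
    #(box d L) ≤ #((box d (L + 1)).filter fun y => y + Pi.single i 1 ∈ box d (L + 1)) :=
  Finset.card_le_card (box_subset_filter_box_succ i L)

end Boxes

/-! ### The energy of a translation invariant Gibbs state and the pressure -/

section Energy

variable {d : ℕ}

/-- **The bond sum of a translation invariant measure over the edges inside `B(L+1)`**: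
`∑_{e ∈ ℰ_{B(L+1)}} μ(σ_e) ≤ |B(L+1)| ∑ᵢ ⟨σ_0σ_{eᵢ}⟩_μ + d (|B(L+1)| - |B(L)|)` (there are between
`|B(L)|` and `|B(L+1)|` edges in each direction, each contributing `⟨σ_0σ_{eᵢ}⟩_μ ∈ [-1, 1]`). [folklore] -/
theorem sum_edgesIn_integral_bondSpin_le {μ : Measure (SpinConfig (Site d))} [IsProbabilityMeasure μ]
    (hμ : IsTranslationInvariantMeasure μ) (L : ℕ) :
    ∑ e ∈ edgesIn (zdGraph d) (box d (L + 1)), ∫ σ, bondSpin σ e ∂μ ≤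
      #(box d (L + 1)) * ∑ i, spinCorr μ {0, Pi.single i 1} +
        d * ((#(box d (L + 1)) : ℝ) - #(box d L)) := by
  rw [sum_edgesIn_zd, Finset.mul_sum]
  have hterm : ∀ i : Fin d,
      ∑ y ∈ (box d (L + 1)).filter (fun y => y + Pi.single i 1 ∈ box d (L + 1)),
          ∫ σ, bondSpin σ s(y, y + Pi.single i 1) ∂μ ≤
        #(box d (L + 1)) * spinCorr μ {0, Pi.single i 1} + ((#(box d (L + 1)) : ℝ) - #(box d L)) := by
    intro i
    set F := (box d (L + 1)).filter (fun y => y + Pi.single i 1 ∈ box d (L + 1)) with hF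
    set c := spinCorr μ {0, Pi.single i 1} with hc
    have hsum : ∑ y ∈ F, ∫ σ, bondSpin σ s(y, y + Pi.single i 1) ∂μ = #F * c := by
      rw [Finset.sum_congr rfl fun y _ => integral_bondSpin_dirEdge_of_isTranslationInvariant hμ y i,
        Finset.sum_const, nsmul_eq_mul]
    have hFle : (#F : ℝ) ≤ #(box d (L + 1)) := by exact_mod_cast Finset.card_le_card (Finset.filter_subset _ _)
    have hFge : (#(box d L) : ℝ) ≤ #F := by exact_mod_cast card_box_le_card_filter_dirEdge i L
    have hc1 : |c| ≤ 1 := abs_spinCorr_le_one μ _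
    rw [hsum]
    have key : (#F : ℝ) * c = #(box d (L + 1)) * c - (#(box d (L + 1)) - #F) * c := by ring
    rw [key]
    have h2 : -((#(box d (L + 1)) - (#F : ℝ)) * c) ≤ (#(box d (L + 1)) - (#F : ℝ)) * 1 := by
      have hnn : 0 ≤ (#(box d (L + 1)) : ℝ) - #F := sub_nonneg.2 hFle
      have := abs_le.1 hc1
      nlinarith [this.1, this.2]
    linarith
  calc ∑ i, ∑ y ∈ (box d (L + 1)).filter (fun y => y + Pi.single i 1 ∈ box d (L + 1)),
          ∫ σ, bondSpin σ s(y, y + Pi.single i 1) ∂μ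
      ≤ ∑ i : Fin d, (#(box d (L + 1)) * spinCorr μ {0, Pi.single i 1} +
          ((#(box d (L + 1)) : ℝ) - #(box d L))) := Finset.sum_le_sum fun i _ => hterm i
    _ = ∑ i : Fin d, (#(box d (L + 1)) : ℝ) * spinCorr μ {0, Pi.single i 1} +
          d * ((#(box d (L + 1)) : ℝ) - #(box d L)) := by
        rw [Finset.sum_add_distrib, Finset.sum_const, Finset.card_univ, Fintype.card_fin,
          nsmul_eq_mul]

/-- **The bond sum over all edges touching `B(L+1)`** adds at most `|∂ᵉB(L+1)|` to the interior
sum (each bond expectation is at most `1` in absolute value). [folklore] -/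
theorem sum_edgesTouching_integral_bondSpin_le {μ : Measure (SpinConfig (Site d))}
    [IsProbabilityMeasure μ] (hμ : IsTranslationInvariantMeasure μ) (L : ℕ) :
    ∑ e ∈ edgesTouching (zdGraph d) (box d (L + 1)), ∫ σ, bondSpin σ e ∂μ ≤
      #(box d (L + 1)) * ∑ i, spinCorr μ {0, Pi.single i 1} +
        d * ((#(box d (L + 1)) : ℝ) - #(box d L)) + #(edgeBoundary (zdGraph d) (box d (L + 1))) := by
  have hsplit := Finset.sum_sdiff (edgesIn_subset_edgesTouching (G := zdGraph d) (box d (L + 1)))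
    (f := fun e => ∫ σ, bondSpin σ e ∂μ)
  rw [← hsplit]
  have hbdry : ∑ e ∈ edgesTouching (zdGraph d) (box d (L + 1)) \ edgesIn (zdGraph d) (box d (L + 1)),
      ∫ σ, bondSpin σ e ∂μ ≤ #(edgeBoundary (zdGraph d) (box d (L + 1))) := by
    rw [show edgesTouching (zdGraph d) (box d (L + 1)) \ edgesIn (zdGraph d) (box d (L + 1)) =
      edgeBoundary (zdGraph d) (box d (L + 1)) from rfl]
    calc ∑ e ∈ edgeBoundary (zdGraph d) (box d (L + 1)), ∫ σ, bondSpin σ e ∂μ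
        ≤ ∑ _e ∈ edgeBoundary (zdGraph d) (box d (L + 1)), (1 : ℝ) :=
          Finset.sum_le_sum fun e _ => integral_bondSpin_le_one μ e
      _ = #(edgeBoundary (zdGraph d) (box d (L + 1))) := by simp
  linarith [sum_edgesIn_integral_bondSpin_le hμ L, hbdry]

/-- **The chord bound for one boundary condition** (Friedli–Velenik 2017, Lemma 3.5 / Exercise
3.2, convexity of `log Z` in `β`, and the proof of Thm. 3.6, p. 97, boundary conditions change
`log Z` by at most `|β||∂ᵉΛ|`): for every `η` and all real `β' , β`,
`log Z^∅_Λ(β) - log Z^∅_Λ(β') - (|β|+|β'|)|∂ᵉΛ| ≤ (β - β') ⟨-H^η_Λ⟩^η_{Λ;β}`. [cite: FriedliVelenik2017, §3.2.1, Exercise 3.2 and Thm. 3.6 (proof)] -/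
theorem log_partitionFunction_free_sub_le_mul_isingExpect_neg_hamiltonian (Λ : Finset (Site d))
    (β β' : ℝ) (η : SpinConfig (Site d)) :
    Real.log (isingPartitionFunction (zdGraph d) Λ β 0 .free) -
        Real.log (isingPartitionFunction (zdGraph d) Λ β' 0 .free) -
        (|β| + |β'|) * #(edgeBoundary (zdGraph d) Λ) ≤
      (β - β') * isingExpect (zdGraph d) Λ β 0 (.fixed η)
        (fun σ => -isingHamiltonian (zdGraph d) Λ 0 (.fixed η) σ) := by
  have hchord := mul_isingExpect_neg_hamiltonian_le_log_sub (zdGraph d) Λ β β' 0 (.fixed η)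
  have hb := abs_log_isingPartitionFunction_sub_free_le (zdGraph d) Λ β 0 (.fixed η)
  have hb' := abs_log_isingPartitionFunction_sub_free_le (zdGraph d) Λ β' 0 (.fixed η)
  rw [abs_sub_le_iff] at hb hb'
  have hc : Real.log (isingPartitionFunction (zdGraph d) Λ β 0 (.fixed η)) -
      Real.log (isingPartitionFunction (zdGraph d) Λ β' 0 (.fixed η)) ≤
      (β - β') * isingExpect (zdGraph d) Λ β 0 (.fixed η)
        (fun σ => -isingHamiltonian (zdGraph d) Λ 0 (.fixed η) σ) := by
    have h := hchord
    rw [show (β' - β) * isingExpect (zdGraph d) Λ β 0 (.fixed η)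
        (fun σ => -isingHamiltonian (zdGraph d) Λ 0 (.fixed η) σ) =
        -((β - β') * isingExpect (zdGraph d) Λ β 0 (.fixed η)
          (fun σ => -isingHamiltonian (zdGraph d) Λ 0 (.fixed η) σ)) by ring] at h
    linarith
  linarith [hb.1, hb.2, hb'.1, hb'.2]

/-- **The DLR-averaged energy bound in a box** (Lebowitz 1977, §3, p. 470, "general arguments",
in finite volume): for `μ ∈ 𝒢(β,0)` and all real `β'`,
`log Z^∅_Λ(β) - log Z^∅_Λ(β') - (|β|+|β'|)|∂ᵉΛ| ≤ (β - β') ∑_{e ∈ ℰ^b_Λ} μ(σ_e)`: integrate the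
chord bound against `μ(dη)`; by the DLR equations `∫ ⟨σ_e⟩^η_Λ μ(dη) = μ(σ_e)`. [cite: Lebowitz1977, §3, proof of Thm. 2, p. 470] -/
theorem log_partitionFunction_free_sub_le_mul_sum_integral_bondSpin {β β' : ℝ}
    {μ : Measure (SpinConfig (Site d))} (hμ : IsGibbsMeasure (isingSpecification (zdGraph d) β 0) μ)
    (Λ : Finset (Site d)) :
    Real.log (isingPartitionFunction (zdGraph d) Λ β 0 .free) -
        Real.log (isingPartitionFunction (zdGraph d) Λ β' 0 .free) -
        (|β| + |β'|) * #(edgeBoundary (zdGraph d) Λ) ≤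
      (β - β') * ∑ e ∈ edgesTouching (zdGraph d) Λ, ∫ σ, bondSpin σ e ∂μ := by
  haveI := hμ.isProbabilityMeasure
  set K := Real.log (isingPartitionFunction (zdGraph d) Λ β 0 .free) -
    Real.log (isingPartitionFunction (zdGraph d) Λ β' 0 .free) -
    (|β| + |β'|) * #(edgeBoundary (zdGraph d) Λ) with hK
  have hE : ∀ η : SpinConfig (Site d), isingExpect (zdGraph d) Λ β 0 (.fixed η)
      (fun σ => -isingHamiltonian (zdGraph d) Λ 0 (.fixed η) σ) =
      ∑ e ∈ edgesTouching (zdGraph d) Λ,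
        isingExpect (zdGraph d) Λ β 0 (.fixed η) (fun σ => bondSpin σ e) := fun η => by
    rw [isingExpect_neg_hamiltonian_zero_field, interactionEdges_fixed]
  have hpt : ∀ η : SpinConfig (Site d), K ≤ (β - β') * ∑ e ∈ edgesTouching (zdGraph d) Λ,
      isingExpect (zdGraph d) Λ β 0 (.fixed η) (fun σ => bondSpin σ e) := fun η => by
    rw [← hE η]
    exact log_partitionFunction_free_sub_le_mul_isingExpect_neg_hamiltonian Λ β β' η
  have hi : ∀ e : Sym2 (Site d), Integrable (fun η : SpinConfig (Site d) =>
      isingExpect (zdGraph d) Λ β 0 (.fixed η) (fun σ => bondSpin σ e)) μ := fun e =>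
    integrable_isingExpect_fixed (zdGraph d) μ Λ β 0 (measurable_bondSpin e)
      (fun σ => abs_bondSpin_le_one σ e)
  have hint : ∀ e : Sym2 (Site d),
      ∫ η, isingExpect (zdGraph d) Λ β 0 (.fixed η) (fun σ => bondSpin σ e) ∂μ =
        ∫ σ, bondSpin σ e ∂μ := fun e =>
    integral_isingExpect_fixed_eq_integral (zdGraph d) hμ Λ (measurable_bondSpin e)
      (fun σ => abs_bondSpin_le_one σ e)
  have hsum : Integrable (fun η : SpinConfig (Site d) => (β - β') *
      ∑ e ∈ edgesTouching (zdGraph d) Λ,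
        isingExpect (zdGraph d) Λ β 0 (.fixed η) (fun σ => bondSpin σ e)) μ :=
    (integrable_finsetSum _ fun e _ => hi e).const_mul (β - β')
  calc K = ∫ _ : SpinConfig (Site d), K ∂μ := by simp
    _ ≤ ∫ η, (β - β') * ∑ e ∈ edgesTouching (zdGraph d) Λ,
          isingExpect (zdGraph d) Λ β 0 (.fixed η) (fun σ => bondSpin σ e) ∂μ :=
        integral_mono (integrable_const K) hsum hpt
    _ = (β - β') * ∑ e ∈ edgesTouching (zdGraph d) Λ, ∫ σ, bondSpin σ e ∂μ := by
        rw [integral_const_mul, integral_finsetSum _ fun e _ => hi e]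
        congr 1
        exact Finset.sum_congr rfl fun e _ => hint e

/-- **The energy of a translation invariant Gibbs state bounds the chords of the pressure from
above** (Lebowitz 1977, §3, proof of Thm. 2, p. 470, "general arguments": the energies of
translation invariant states lie between the one-sided derivatives `∂Ψ(β ± 0)/∂β`; here in chord
form, which implies `∂⁻ψ(β) ≤ ∑ᵢ ⟨σ_0σ_{eᵢ}⟩_μ`): for the nearest-neighbour Ising model on `ℤ^d`,
every translation invariant `μ ∈ 𝒢(β, 0)` and every `β' < β`,
`ψ(β) - ψ(β') ≤ (β - β') ∑ᵢ ⟨σ_0σ_{eᵢ}⟩_μ`. [cite: Lebowitz1977, §3, proof of Thm. 2, p. 470] -/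
theorem pressure_sub_pressure_le_mul_sum_spinCorr_nn {β β' : ℝ} (hlt : β' < β)
    {μ : Measure (SpinConfig (Site d))} (hμG : μ ∈ isingGibbsMeasures d β 0)
    (hμT : IsTranslationInvariantMeasure μ) :
    pressure d β 0 - pressure d β' 0 ≤ (β - β') * ∑ i, spinCorr μ {0, Pi.single i 1} := by
  have hμ : IsGibbsMeasure (isingSpecification (zdGraph d) β 0) μ := hμG
  haveI := hμ.isProbabilityMeasure
  have hδ : 0 < β - β' := sub_pos.2 hlt
  set c := ∑ i, spinCorr μ {0, Pi.single i 1} with hc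
  have hN : ∀ L : ℕ, (0 : ℝ) < #(box d (L + 1)) := fun L => by
    exact_mod_cast Finset.card_pos.2 (box_nonempty d (L + 1))
  -- the inequality in the box `B(L+1)`, divided by `|B(L+1)|`
  have h3 : ∀ L : ℕ,
      pressureIn (zdGraph d) (box d (L + 1)) β 0 .free - pressureIn (zdGraph d) (box d (L + 1)) β' 0 .free -
          (|β| + |β'|) * ((#(edgeBoundary (zdGraph d) (box d (L + 1))) : ℝ) / #(box d (L + 1))) ≤
        (β - β') * (c + d * (1 - (#(box d L) : ℝ) / #(box d (L + 1))) +
          (#(edgeBoundary (zdGraph d) (box d (L + 1))) : ℝ) / #(box d (L + 1))) := by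
    intro L
    have hNne : (#(box d (L + 1)) : ℝ) ≠ 0 := (hN L).ne'
    have h1 := log_partitionFunction_free_sub_le_mul_sum_integral_bondSpin (β' := β') hμ (box d (L + 1))
    have h2 := (h1.trans (mul_le_mul_of_nonneg_left (sum_edgesTouching_integral_bondSpin_le hμT L) hδ.le))
    have h4 := div_le_div_of_nonneg_right h2 (hN L).le
    rw [sub_div, sub_div, mul_div_assoc] at h4
    rw [pressureIn, pressureIn]
    refine h4.trans_eq ?_
    field_simp
    ring
  -- limits
  have hψ : ∀ b : ℝ, Tendsto (fun L : ℕ => pressureIn (zdGraph d) (box d (L + 1)) b 0 .free) atTop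
      (𝓝 (pressure d b 0)) := fun b =>
    (hasBoxLimit_pressureIn_holds d b 0 .free).comp (tendsto_add_atTop_nat 1)
  have hbd : Tendsto (fun L : ℕ => ((#(edgeBoundary (zdGraph d) (box d (L + 1))) : ℝ) / #(box d (L + 1))))
      atTop (𝓝 0) := (tendsto_card_edgeBoundary_box_div d).comp (tendsto_add_atTop_nat 1)
  have hL : Tendsto (fun L : ℕ => pressureIn (zdGraph d) (box d (L + 1)) β 0 .free -
      pressureIn (zdGraph d) (box d (L + 1)) β' 0 .free -
        (|β| + |β'|) * ((#(edgeBoundary (zdGraph d) (box d (L + 1))) : ℝ) / #(box d (L + 1)))) atTop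
      (𝓝 (pressure d β 0 - pressure d β' 0 - (|β| + |β'|) * 0)) :=
    ((hψ β).sub (hψ β')).sub (hbd.const_mul _)
  have hR : Tendsto (fun L : ℕ => (β - β') * (c + d * (1 - (#(box d L) : ℝ) / #(box d (L + 1))) +
      (#(edgeBoundary (zdGraph d) (box d (L + 1))) : ℝ) / #(box d (L + 1)))) atTop
      (𝓝 ((β - β') * (c + d * (1 - 1) + 0))) :=
    ((tendsto_const_nhds.add ((tendsto_const_nhds.sub (tendsto_card_box_div_card_box_succ d)).const_mul
      _)).add hbd).const_mul _
  have := le_of_tendsto_of_tendsto' hL hR h3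
  simpa using this

/-- **The lower chord bound from the plus boundary condition** (Step A of the tree's
`SharpnessLROProofs`, isolated; Lebowitz 1977, §3, p. 470, with Friedli–Velenik 2017, Thm. 3.6):
for `0 ≤ β' < β`, `(β - β') ∑ᵢ ⟨σ_0σ_{eᵢ}⟩⁺_{β'} ≤ ψ(β) - ψ(β')`. [cite: Lebowitz1977, §3, proof of Thm. 2, p. 470] -/
theorem mul_sum_plusCorr_nn_le_pressure_sub_pressure {β' β : ℝ} (hβ' : 0 ≤ β') (hlt : β' < β) :
    (β - β') * ∑ i, plusCorr d β' 0 {0, Pi.single i 1} ≤ pressure d β 0 - pressure d β' 0 := by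
  have hδ : 0 < β - β' := sub_pos.2 hlt
  set P := ∑ i, plusCorr d β' 0 {0, Pi.single i 1} with hP
  have hN : ∀ L : ℕ, (0 : ℝ) < #(box d (L + 1)) := fun L => by
    exact_mod_cast Finset.card_pos.2 (box_nonempty d (L + 1))
  have h1 : ∀ L : ℕ, (β - β') * ((#(box d L) : ℝ) / #(box d (L + 1))) * P ≤
      pressureIn (zdGraph d) (box d (L + 1)) β 0 .plus -
        pressureIn (zdGraph d) (box d (L + 1)) β' 0 .plus := by
    intro L
    have hJ := mul_isingExpect_neg_hamiltonian_le_log_sub (zdGraph d) (box d (L + 1)) β' β 0 .plus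
    have hE := le_isingExpect_neg_hamiltonian_plus_box (d := d) hβ' L
    have hb : (#(box d (L + 1)) : ℝ) ≠ 0 := (hN L).ne'
    rw [pressureIn, pressureIn, ← sub_div, le_div_iff₀ (hN L)]
    calc (β - β') * ((#(box d L) : ℝ) / #(box d (L + 1))) * P * #(box d (L + 1))
        = (β - β') * (#(box d L) * P) := by field_simp
      _ ≤ (β - β') * isingExpect (zdGraph d) (box d (L + 1)) β' 0 .plus
            (fun σ => -isingHamiltonian (zdGraph d) (box d (L + 1)) 0 .plus σ) :=
          mul_le_mul_of_nonneg_left hE hδ.le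
      _ ≤ _ := hJ
  have hlim : Tendsto (fun L : ℕ => pressureIn (zdGraph d) (box d (L + 1)) β 0 .plus -
        pressureIn (zdGraph d) (box d (L + 1)) β' 0 .plus) atTop (𝓝 (pressure d β 0 - pressure d β' 0)) :=
    ((hasBoxLimit_pressureIn_holds d β 0 .plus).comp (tendsto_add_atTop_nat 1)).sub
      ((hasBoxLimit_pressureIn_holds d β' 0 .plus).comp (tendsto_add_atTop_nat 1))
  have hl : Tendsto (fun L : ℕ => (β - β') * ((#(box d L) : ℝ) / #(box d (L + 1))) * P) atTop
      (𝓝 ((β - β') * 1 * P)) :=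
    (tendsto_const_nhds.mul (tendsto_card_box_div_card_box_succ d)).mul tendsto_const_nhds
  rw [mul_one] at hl
  exact le_of_tendsto_of_tendsto hl hlim (Eventually.of_forall h1)

/-- **Lebowitz 1977, §3, p. 470 ("general arguments"), proved in elementary form: the
nearest-neighbour energy of a translation invariant Gibbs state at `β` is at least the plus
energy at every `β' < β`.** For the nearest-neighbour Ising model on `ℤ^d`, every translation
invariant `μ ∈ 𝒢(β, 0)` and `0 ≤ β' < β`:
`∑ᵢ ⟨σ_0σ_{eᵢ}⟩⁺_{β'} ≤ ∑ᵢ ⟨σ_0σ_{eᵢ}⟩_μ`. (In particular the energy density of `μ` is at least the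
left derivative `∂⁻ψ(β) = lim_{β'↑β} ∑ᵢ ⟨σ_0σ_{eᵢ}⟩⁺_{β'}` of the pressure.) [cite: Lebowitz1977, §3, proof of Thm. 2, p. 470] -/
theorem sum_plusCorr_nn_le_sum_spinCorr_nn_of_isTranslationInvariant {β' β : ℝ} (hβ' : 0 ≤ β')
    (hlt : β' < β) {μ : Measure (SpinConfig (Site d))} (hμG : μ ∈ isingGibbsMeasures d β 0)
    (hμT : IsTranslationInvariantMeasure μ) :
    ∑ i, plusCorr d β' 0 {0, Pi.single i 1} ≤ ∑ i, spinCorr μ {0, Pi.single i 1} :=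
  le_of_mul_le_mul_left ((mul_sum_plusCorr_nn_le_pressure_sub_pressure hβ' hlt).trans
    (pressure_sub_pressure_le_mul_sum_spinCorr_nn hlt hμG hμT)) (sub_pos.2 hlt)

end Energy

end Literature.Probability.LatticeModels
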